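import Mathlib
import Summits.KontsevichZagierPeriods.Zeta5Search.BrickLaurentValuation

/-!
# BrickCellValuation — the COMPENSATED VALUATION LEMMA at every level: for `n < p^{L+1}`,
`v_p(c_{K,s}(n)) ≥ v_p(c_{K,A}(n)) − L·(A−s) − B·σ^{(L)}_K`, `σ^{(L)}_K = [n+K ≥ p^{L+1}] + [2n−K ≥ p^{L+1}]`
(zi-p2 THEOREM 5 Step C, THEOREM 6 Step C⁺, PLAN-T7 L7.1; cell zeta5-irr)

HONEST FRAMING: systematic search; no irrationality claim unless certified. INSTRUMENT lemma of the ζ(5)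
census cell zeta5-irr (HOME `run/shared/lean/pub/zeta5-irr/`; memo `zi-p2/probes/B8/thm6/THEOREM6.md` §0
«σ_j := [n + j ≥ p²] + [2n − j ≥ p²] … ṽ_j := v(c_{j,A}(n)) − B·σ_j» and Step C⁺ «(C2⁺) v(c_{j,s}(n)) ≥ ṽ_j − (A − s)»,
`zi-p2/probes/B8/thm7-plan/PLAN-T7.md` L7.1 «v(c_{j,A−d}(n)) ≥ v(c_{j,A}(n)) − 2d − Bσ^{(2)}_j»). Nothing here is
about ζ(5); no irrationality content; filing moves no rung. Filed by the engine seat zi-eng (g8); it is the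
instantiation `w = L`, `e = B·σ^{(L)}_K` of `BrickLaurentValuation.padicValuation_cell_le` (the master bound).

## The statement

Let `p` be prime, `L ≥ 0`, `P = p^{L+1}`, `n < P`, `K ≤ n`, `2B ≤ A`, and either `2K ≠ n` or `ε = 0` (off-centre, or the
symmetric kernel). Put **`sigmaTop p L n K := [P ≤ n + K] + [P ≤ 2n − K]`** (THEOREM 6's `σ_K` at `L = 1`, PLAN-T7's
`σ^{(2)}_K` at `L = 2`). Then for every `s` (`cell_valuation`):

**`v(cell A B ε n K s) ≤ v(cTop A B ε n K) · exp(L·(A−s) + B·sigmaTop p L n K)`**, i.e.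
`v_p(c_{K,s}(n)) ≥ v_p(c_{K,A}(n)) − L(A−s) − Bσ^{(L)}_K`; at `L = 1`, `n < p²`: `= ṽ_K − (A−s)` = (C2⁺); at `n < p²/2`:
`σ = 0` = THEOREM 5 Step C; depth form `laurent_valuation`. The digit counts behind it (`sum_padicValNat_add_sub`,
`sum_padicValNat_sub_sub`): for `K ≤ n < P`, `Σ_{m=1}^{n}(v_p(K+m) − L)⁺ = [P ≤ n+K]` and `Σ_{m=1}^{n}(v_p(n+m−K) − L)⁺ =
[P ≤ 2n−K]` — among `K+1, …, K+n` (all `< 2P`) the only possible multiple of `P` is `P` itself (`padicValNat_sub_eq`).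
-/

namespace Summit.KontsevichZagierPeriods.Zeta5Search.BrickCellValuation

open Finset Nat WithZero
open Summit.KontsevichZagierPeriods.Zeta5Search.BrickTopCoefficient (cTop)
open Summit.KontsevichZagierPeriods.Zeta5Search.BrickLaurent (laurent cell)
open Summit.KontsevichZagierPeriods.Zeta5Search.BrickLaurentValuation (padicValuation_laurent_le)

variable {p : ℕ} [Fact p.Prime]

/-- `σ^{(L)}_K := [p^{L+1} ≤ n + K] + [p^{L+1} ≤ 2n − K]` — the number of `p^{L+1}`-DISTANT numerator roots of `F_K`. -/
def sigmaTop (p L n K : ℕ) : ℕ := (if p ^ (L + 1) ≤ n + K then 1 else 0) + (if p ^ (L + 1) ≤ 2 * n - K then 1 else 0)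

/-- Below `2·p^{L+1}` the only integer of valuation `> L` is `p^{L+1}`: `(v_p(x) − L)⁺ = [x = p^{L+1}]` for
`0 < x < 2p^{L+1}`. -/
theorem padicValNat_sub_eq {L x : ℕ} (hx0 : x ≠ 0) (hx : x < 2 * p ^ (L + 1)) :
    padicValNat p x - L = if x = p ^ (L + 1) then 1 else 0 := by
  have hp : p.Prime := Fact.out
  split_ifs with h
  · rw [h, padicValNat.prime_pow]; omega
  · refine Nat.sub_eq_zero_of_le (not_lt.1 fun hL => h ?_)
    obtain ⟨c, hc⟩ := (padicValNat_dvd_iff_le hx0).2 (Nat.lt_iff_add_one_le.1 hL)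
    have hc1 : c < 2 := by
      by_contra hc2
      have : 2 * p ^ (L + 1) ≤ x := by rw [hc]; exact Nat.mul_comm 2 _ ▸ Nat.mul_le_mul_left _ (not_lt.1 hc2)
      omega
    interval_cases c
    · omega
    · omega

/-- All offsets to the other poles are small: `v_p(d) ≤ L` for `0 < d < p^{L+1}`. -/
theorem padicValNat_le_of_lt_pow {L d : ℕ} (hd0 : 0 < d) (hd : d < p ^ (L + 1)) : padicValNat p d ≤ L := by
  by_contra h
  obtain ⟨c, hc⟩ := (padicValNat_dvd_iff_le hd0.ne').2 (Nat.lt_iff_add_one_le.1 (not_le.1 h))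
  rcases Nat.eq_zero_or_pos c with h0 | h0
  · rw [h0, mul_zero] at hc; omega
  · have : p ^ (L + 1) ≤ d := by rw [hc]; exact Nat.le_mul_of_pos_right _ h0
    omega

/-- **`Σ_{m=1}^{n}(v_p(K+m) − L)⁺ = [p^{L+1} ≤ n + K]`** for `K ≤ n < p^{L+1}`. -/
theorem sum_padicValNat_add_sub {L n K : ℕ} (hn : n < p ^ (L + 1)) (hK : K ≤ n) :
    ∑ m ∈ Icc 1 n, (padicValNat p (K + m) - L) = if p ^ (L + 1) ≤ n + K then 1 else 0 := by
  have h1 : ∀ m ∈ Icc 1 n, padicValNat p (K + m) - L = if m = p ^ (L + 1) - K then 1 else 0 := by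
    intro m hm
    have := mem_Icc.1 hm
    rw [padicValNat_sub_eq (p := p) (by omega) (by omega)]
    exact if_congr (by omega) rfl rfl
  rw [Finset.sum_congr rfl h1, Finset.sum_ite_eq']
  exact if_congr (by rw [mem_Icc]; omega) rfl rfl

/-- **`Σ_{m=1}^{n}(v_p(n+m−K) − L)⁺ = [p^{L+1} ≤ 2n − K]`** for `K ≤ n < p^{L+1}`. -/
theorem sum_padicValNat_sub_sub {L n K : ℕ} (hn : n < p ^ (L + 1)) (hK : K ≤ n) :
    ∑ m ∈ Icc 1 n, (padicValNat p (n + m - K) - L) = if p ^ (L + 1) ≤ 2 * n - K then 1 else 0 := by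
  have h1 : ∀ m ∈ Icc 1 n, padicValNat p (n + m - K) - L = if m = p ^ (L + 1) + K - n then 1 else 0 := by
    intro m hm
    have := mem_Icc.1 hm
    rw [padicValNat_sub_eq (p := p) (by omega) (by omega)]
    exact if_congr (by omega) rfl rfl
  rw [Finset.sum_congr rfl h1, Finset.sum_ite_eq']
  exact if_congr (by rw [mem_Icc]; omega) rfl rfl

/-- The budget of the master bound at level `L`: for `K ≤ n < p^{L+1}`,
`ε(v_p(n−2K) − L)⁺ + BΣ_m[(v_p(K+m) − L)⁺ + (v_p(n+m−K) − L)⁺] = B·σ^{(L)}_K` (the centre term vanishes). -/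
theorem budget_eq {L n K : ℕ} (hn : n < p ^ (L + 1)) (hK : K ≤ n) (ε B : ℕ) :
    ε * (padicValNat p ((n : ℤ) - 2 * K).natAbs - L) +
        B * ∑ m ∈ Icc 1 n, ((padicValNat p (K + m) - L) + (padicValNat p (n + m - K) - L)) =
      B * sigmaTop p L n K := by
  have hc : padicValNat p ((n : ℤ) - 2 * K).natAbs - L = 0 := by
    rcases Nat.eq_zero_or_pos ((n : ℤ) - 2 * K).natAbs with h0 | h0
    · rw [h0]; simp
    · exact Nat.sub_eq_zero_of_le (padicValNat_le_of_lt_pow h0 (by omega))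
  rw [hc, mul_zero, zero_add, Finset.sum_add_distrib, sum_padicValNat_add_sub hn hK, sum_padicValNat_sub_sub hn hK,
    sigmaTop]

/-- **COMPENSATED VALUATION LEMMA, depth form** (THEOREM 5 Step C / THEOREM 6 C⁺ / PLAN-T7 L7.1): for `n < p^{L+1}`,
`K ≤ n`, `2B ≤ A`, and `2K ≠ n` or `ε = 0`:
`v(laurent A B ε n K d) ≤ v(cTop A B ε n K)·exp(L·d + B·σ^{(L)}_K)`, i.e. `v_p(c_{K,A−d}) ≥ v_p(c_{K,A}) − Ld − Bσ`. -/
theorem laurent_valuation {A B : ℕ} (hAB : 2 * B ≤ A) {L ε n K : ℕ} (hn : n < p ^ (L + 1)) (hK : K ≤ n)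
    (hc : 2 * K ≠ n ∨ ε = 0) (d : ℕ) :
    Rat.padicValuation p (laurent A B ε n K d) ≤
      Rat.padicValuation p (cTop A B ε n K) * exp ((L : ℤ) * d + (B * sigmaTop p L n K : ℕ)) :=
  padicValuation_laurent_le hAB hK hc (fun e he0 hen => padicValNat_le_of_lt_pow he0 (by omega))
    (budget_eq hn hK ε B).le d

/-- **COMPENSATED VALUATION LEMMA (C2⁺), cell form**: for `n < p^{L+1}`, `K ≤ n`, `2B ≤ A`, `2K ≠ n` or `ε = 0`, and
every `s`: `v(cell A B ε n K s) ≤ v(cTop A B ε n K)·exp(L·(A−s) + B·σ^{(L)}_K)`, i.e.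
`v_p(c_{K,s}(n)) ≥ v_p(c_{K,A}(n)) − L(A−s) − B·σ^{(L)}_K` (`= ṽ_K − (A−s)` at `L = 1`). -/
theorem cell_valuation {A B : ℕ} (hAB : 2 * B ≤ A) {L ε n K : ℕ} (hn : n < p ^ (L + 1)) (hK : K ≤ n)
    (hc : 2 * K ≠ n ∨ ε = 0) (s : ℕ) :
    Rat.padicValuation p (cell A B ε n K s) ≤
      Rat.padicValuation p (cTop A B ε n K) * exp ((L : ℤ) * (A - s : ℕ) + (B * sigmaTop p L n K : ℕ)) :=
  laurent_valuation hAB hn hK hc (A - s)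

omit [Fact p.Prime] in
/-- THEOREM 5's regime `2n < p^{L+1}` (e.g. `n < p²/2`): no distant roots, `σ^{(L)}_K = 0`. -/
theorem sigmaTop_eq_zero {L n K : ℕ} (hn : 2 * n < p ^ (L + 1)) (hK : K ≤ n) : sigmaTop p L n K = 0 := by
  rw [sigmaTop, if_neg (by omega), if_neg (by omega)]

/-- **THEOREM 5 Step C verbatim** (`2n < p^{L+1}`): `v_p(c_{K,s}(n)) ≥ v_p(c_{K,A}(n)) − L(A−s)`. -/
theorem cell_valuation_of_two_mul_lt {A B : ℕ} (hAB : 2 * B ≤ A) {L ε n K : ℕ} (hn : 2 * n < p ^ (L + 1))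
    (hK : K ≤ n) (hc : 2 * K ≠ n ∨ ε = 0) (s : ℕ) :
    Rat.padicValuation p (cell A B ε n K s) ≤ Rat.padicValuation p (cTop A B ε n K) * exp ((L : ℤ) * (A - s : ℕ)) := by
  have h := cell_valuation (p := p) (L := L) (ε := ε) hAB (by omega) hK hc s
  rwa [sigmaTop_eq_zero hn hK, mul_zero, Nat.cast_zero, add_zero] at h

end Summit.KontsevichZagierPeriods.Zeta5Search.BrickCellValuation
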